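import Mathlib
import HarnessLib
import Summits.HubbardSuperconductivity.HubbardSuperconductivity.Theorems.KLProgrammeFreeBandRadiusDerivBoxesSound
import Literature.MathematicalPhysics.QuantumLattice.HubbardFermiRadiusBandSmooth

/-!
# Route `KLProgramme` — ENGINE crux `KLRegimeEngineV17F2` (stmt-HubbardSuperconductivity-20437), row (C) `hcertA : KlwjCertA`:
# the CERTIFICATE TREE for `|u′|` (bisection in `μ` and in `sin θ`), its kernel checker and its soundness; the `D₄` reduction of `|u′|`
# (cell gate-hubbard-kl, seat p1b g19)

* `R1Tree` — a binary bisection tree whose leaves are `R1Box`es; `R1Tree.check r m1 m2 s1 s2 top` walks the tree over the region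
  `[m1, m2]/10⁶ × {θ ∈ [0, π/4] : s1 ≤ 10⁶ sin θ (≤ s2 unless top)}` and checks every leaf box CONTAINS its region and passes `R1Box.check r`;
* **`R1Tree.sound`** — `check = true` ⇒ `|u′_μ(θ)|·10⁴ ≤ r` on the region (structural induction + `abs_bandFermiRadiusDeriv_le_of_check`);
* `exists_octant_angle_deriv` — the `D₄` fold of `…FreeBandPolarOctant` also preserves `|∂_θF|`, hence `|u′|`;
* **`abs_deriv_bandFermiRadius_le_of_tree`** — a checked tree over `[a, b]/10⁶ × [0, π/4]` bounds `|deriv (bandFermiRadius μ) θ|·10⁴ ≤ r` for EVERY angle.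
The certificate trees for the tables are in `…WindowJetsR1A/B`.  Elementary; nothing about the Hubbard model is asserted. [folklore]
-/

noncomputable section

namespace Summit.HubbardSuperconductivity.HubbardSuperconductivity.Theorems.PerturbedFermiCurve

set_option linter.dupNamespace false -- summit = problem name (single-conjunct summit), D-0017

open Real Set Literature.MathematicalPhysics.QuantumLattice

/-! ## §1 The tree and its checker -/

/-- A bisection certificate: leaves are boxes, nodes split the `μ`-interval at `m/10⁶` or the `sin θ`-interval at `σ/10⁶`. -/
inductive R1Tree where
  /-- a leaf box -/
  | leaf (B : R1Box) : R1Tree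
  /-- split `[m1, m2]` at `m` -/
  | splitMu (m : ℤ) (tlo thi : R1Tree) : R1Tree
  /-- split `[s1, s2]` at `σ` (the upper part keeps the `top` flag) -/
  | splitS (σ : ℕ) (tlo thi : R1Tree) : R1Tree

/-- **The tree checker** over the region `(m1, m2, s1, s2, top)`. -/
def R1Tree.check (r : ℕ) : R1Tree → ℤ → ℤ → ℕ → ℕ → Bool → Bool
  | .leaf B, m1, m2, s1, s2, top =>
      decide (B.m1 ≤ m1) && decide (m2 ≤ B.m2) && decide (B.s1 ≤ s1) && (B.top == top) && (top || decide (s2 ≤ B.s2)) &&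
        B.check r
  | .splitMu m tlo thi, m1, m2, s1, s2, top => tlo.check r m1 m s1 s2 top && thi.check r m m2 s1 s2 top
  | .splitS σ tlo thi, m1, m2, s1, s2, top => tlo.check r m1 m2 s1 σ false && thi.check r m1 m2 σ s2 top

/-! ## §2 Soundness of the tree checker -/

section Sound

variable {μ : ℝ} (hμ₁ : -4 < μ) (hμ₂ : μ < 0)
include hμ₁ hμ₂

/-- **SOUNDNESS**: a checked tree bounds `|u′|·10⁴ ≤ r` on its whole region. -/
theorem R1Tree.sound {r : ℕ} : ∀ (t : R1Tree) (m1 m2 : ℤ) (s1 s2 : ℕ) (top : Bool), t.check r m1 m2 s1 s2 top = true →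
    (m1 : ℝ) ≤ μ * 10 ^ 6 → μ * 10 ^ 6 ≤ (m2 : ℝ) → ∀ {θ : ℝ}, θ ∈ Icc 0 (π / 4) → (s1 : ℝ) ≤ Real.sin θ * 10 ^ 6 →
    (top = false → Real.sin θ * 10 ^ 6 ≤ (s2 : ℝ)) → |bandFermiRadiusDeriv μ θ| * 10 ^ 4 ≤ r
  | .leaf B, m1, m2, s1, s2, top, h, hm1, hm2, θ, hθ, hs1, hs2 => by
    simp only [R1Tree.check, Bool.and_eq_true, decide_eq_true_eq, beq_iff_eq, Bool.or_eq_true] at h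
    obtain ⟨⟨⟨⟨⟨hB1, hB2⟩, hB3⟩, hBt⟩, hBs⟩, hcheck⟩ := h
    have hB1' : (B.m1 : ℝ) ≤ m1 := by exact_mod_cast hB1
    have hB2' : (m2 : ℝ) ≤ B.m2 := by exact_mod_cast hB2
    have hB3' : (B.s1 : ℝ) ≤ s1 := by exact_mod_cast hB3
    refine abs_bandFermiRadiusDeriv_le_of_check hμ₁ hμ₂ hcheck (hB1'.trans hm1) (hm2.trans hB2') hθ (hB3'.trans hs1) ?_
    intro hBtop
    rw [hBt] at hBtop
    rcases hBs with ht | hs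
    · rw [hBtop] at ht; exact absurd ht (by decide)
    · have hs' : (s2 : ℝ) ≤ B.s2 := by exact_mod_cast hs
      exact (hs2 hBtop).trans hs'
  | .splitMu m tlo thi, m1, m2, s1, s2, top, h, hm1, hm2, θ, hθ, hs1, hs2 => by
    simp only [R1Tree.check, Bool.and_eq_true] at h
    rcases le_total (μ * 10 ^ 6) (m : ℝ) with hle | hge
    · exact R1Tree.sound tlo m1 m s1 s2 top h.1 hm1 hle hθ hs1 hs2
    · exact R1Tree.sound thi m m2 s1 s2 top h.2 hge hm2 hθ hs1 hs2
  | .splitS σ tlo thi, m1, m2, s1, s2, top, h, hm1, hm2, θ, hθ, hs1, hs2 => by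
    simp only [R1Tree.check, Bool.and_eq_true] at h
    rcases le_total (Real.sin θ * 10 ^ 6) (σ : ℝ) with hle | hge
    · exact R1Tree.sound tlo m1 m2 s1 σ false h.1 hm1 hm2 hθ hs1 (fun _ => hle)
    · exact R1Tree.sound thi m1 m2 σ s2 top h.2 hm1 hm2 hθ hge hs2

end Sound

/-! ## §3 The `D₄` reduction of `|u′|` and the all-angle statement -/

/-- `|c sin(ts) − s sin(tc)|` depends on `(c, s)` only through `{|c|, |s|}` (odd in each, antisymmetric). -/
theorem abs_mul_sin_sub_eq_abs (t c s : ℝ) :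
    |c * Real.sin (t * s) - s * Real.sin (t * c)| = |(|c|) * Real.sin (t * |s|) - |s| * Real.sin (t * |c|)| := by
  rcases le_total 0 c with hc | hc <;> rcases le_total 0 s with hs | hs
  · rw [abs_of_nonneg hc, abs_of_nonneg hs]
  · rw [abs_of_nonneg hc, abs_of_nonpos hs]
    have e : c * Real.sin (t * -s) - -s * Real.sin (t * c) = -(c * Real.sin (t * s) - s * Real.sin (t * c)) := by
      rw [mul_neg t s, Real.sin_neg]; ring
    rw [e, abs_neg]
  · rw [abs_of_nonpos hc, abs_of_nonneg hs]
    have e : -c * Real.sin (t * s) - s * Real.sin (t * -c) = -(c * Real.sin (t * s) - s * Real.sin (t * c)) := by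
      rw [mul_neg t c, Real.sin_neg]; ring
    rw [e, abs_neg]
  · rw [abs_of_nonpos hc, abs_of_nonpos hs]
    have e : -c * Real.sin (t * -s) - -s * Real.sin (t * -c) = c * Real.sin (t * s) - s * Real.sin (t * c) := by
      rw [mul_neg t s, mul_neg t c, Real.sin_neg, Real.sin_neg]; ring
    rw [e]

/-- **`D₄` reduction preserving `|∂_θF|`.**  For every angle there is `θ' ∈ [0, π/4]` with the same level function, radial slope, sup norm AND the same
`|∂_θF(·, t)|` for every `t`. -/
theorem exists_octant_angle_deriv (θ : ℝ) : ∃ θ' ∈ Icc 0 (π / 4),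
    (∀ t, rayDispersion (θ', t) = rayDispersion (θ, t)) ∧ (∀ t, rayDispersionDt θ' t = rayDispersionDt θ t) ∧
      ‖dir θ'‖ = ‖dir θ‖ ∧ (∀ t, |rayDispersionDθ θ' t| = |rayDispersionDθ θ t|) := by
  -- the representative of `exists_octant_angle` is `arcsin (min |cos θ| |sin θ|)`; we rebuild it to read off `cos θ'`, `sin θ'`
  set m := min |Real.cos θ| |Real.sin θ| with hm
  set M := max |Real.cos θ| |Real.sin θ| with hM
  have hm0 : 0 ≤ m := le_min (abs_nonneg _) (abs_nonneg _)
  have hmM : m ≤ M := min_le_max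
  have hM0 : 0 ≤ M := hm0.trans hmM
  have hcs := Real.cos_sq_add_sin_sq θ
  have hsq : m ^ 2 + M ^ 2 = 1 := by
    rcases le_total |Real.cos θ| |Real.sin θ| with h1 | h1
    · rw [hm, hM, min_eq_left h1, max_eq_right h1, sq_abs, sq_abs]; exact hcs
    · rw [hm, hM, min_eq_right h1, max_eq_left h1, sq_abs, sq_abs]; linarith
  have hm1 : m ≤ 1 := by nlinarith
  have hm2 : m ≤ Real.sqrt 2 / 2 := by
    have h2 : m ^ 2 ≤ (Real.sqrt 2 / 2) ^ 2 := by
      rw [div_pow, Real.sq_sqrt (by norm_num : (0 : ℝ) ≤ 2)]; nlinarith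
    exact (pow_le_pow_iff_left₀ hm0 (by positivity) two_ne_zero).1 h2
  have hsin : Real.sin (Real.arcsin m) = m := Real.sin_arcsin (by linarith) hm1
  have hcos : Real.cos (Real.arcsin m) = M := by
    rw [Real.cos_arcsin]
    have : 1 - m ^ 2 = M ^ 2 := by linarith
    rw [this, Real.sqrt_sq hM0]
  have hpair : ∀ f : ℝ → ℝ, f |Real.cos θ| + f |Real.sin θ| = f M + f m := by
    intro f
    rcases le_total |Real.cos θ| |Real.sin θ| with h1 | h1
    · rw [hm, hM, min_eq_left h1, max_eq_right h1, add_comm]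
    · rw [hm, hM, min_eq_right h1, max_eq_left h1]
  refine ⟨Real.arcsin m, ⟨Real.arcsin_nonneg.2 hm0, ?_⟩, ?_, ?_, ?_, ?_⟩
  · rw [Real.arcsin_le_iff_le_sin ⟨by linarith, hm1⟩ ⟨by linarith [Real.pi_pos], by linarith [Real.pi_pos]⟩,
      Real.sin_pi_div_four]
    exact hm2
  · intro t
    rw [rayDispersion_eq, rayDispersion_eq]
    simp only [hsin, hcos]
    rw [← cos_mul_abs t (Real.cos θ), ← cos_mul_abs t (Real.sin θ), hpair (fun x => Real.cos (t * x))]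
  · intro t
    rw [rayDispersionDt, rayDispersionDt, hsin, hcos, ← abs_mul_sin_mul_abs t (Real.cos θ),
      ← abs_mul_sin_mul_abs t (Real.sin θ), hpair (fun x => x * Real.sin (t * x))]
  · rw [norm_dir, norm_dir, hsin, hcos, abs_of_nonneg hM0, abs_of_nonneg hm0, ← hM, max_eq_left hmM]
  · intro t
    simp only [rayDispersionDθ, hsin, hcos, abs_mul]
    congr 1
    rw [abs_mul_sin_sub_eq_abs t (Real.cos θ) (Real.sin θ)]
    rcases le_total |Real.cos θ| |Real.sin θ| with h1 | h1
    · rw [hm, hM, min_eq_left h1, max_eq_right h1]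
      rw [← abs_neg]
      congr 1; ring
    · rw [hm, hM, min_eq_right h1, max_eq_left h1]

section All

variable {μ : ℝ} (hμ₁ : -4 < μ) (hμ₂ : μ < 0)
include hμ₁ hμ₂

/-- `|u′|` is `D₄`-invariant: it takes the same value at the octant representative. -/
theorem abs_bandFermiRadiusDeriv_eq_octant (θ : ℝ) : ∃ θ' ∈ Icc 0 (π / 4),
    |bandFermiRadiusDeriv μ θ| = |bandFermiRadiusDeriv μ θ'| := by
  obtain ⟨θ', hθ', hF, hDt, hn, hDθ⟩ := exists_octant_angle_deriv θ
  refine ⟨θ', hθ', ?_⟩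
  have hu : bandFermiRadius μ θ' = bandFermiRadius μ θ := bandFermiRadius_eq_of_forall_eq hμ₁ hμ₂ hF hn
  rw [bandFermiRadiusDeriv, bandFermiRadiusDeriv, hu, hDt, abs_div, abs_div, abs_neg, abs_neg, hDθ]

/-- **ALL-ANGLE BOUND FROM A CHECKED TREE** over `[a, b]/10⁶ × [0, π/4]` (root region `s1 = 0`, `top`):
`|deriv (bandFermiRadius μ) θ|·10⁴ ≤ r` for every `μ ∈ [a, b]/10⁶` (`-4 < μ < 0`) and EVERY angle `θ`. -/
theorem abs_deriv_bandFermiRadius_le_of_tree {r : ℕ} {t : R1Tree} {a b : ℤ} (ht : t.check r a b 0 0 true = true)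
    (ha : (a : ℝ) ≤ μ * 10 ^ 6) (hb : μ * 10 ^ 6 ≤ (b : ℝ)) (θ : ℝ) :
    |deriv (bandFermiRadius μ) θ| * 10 ^ 4 ≤ r := by
  rw [deriv_bandFermiRadius hμ₁ hμ₂ θ]
  obtain ⟨θ', hθ', heq⟩ := abs_bandFermiRadiusDeriv_eq_octant hμ₁ hμ₂ θ
  rw [heq]
  refine R1Tree.sound hμ₁ hμ₂ t a b 0 0 true ht ha hb hθ' ?_ (fun h => absurd h (by decide))
  have := (octant_trig hθ').1
  push_cast; linarith

end All

end Summit.HubbardSuperconductivity.HubbardSuperconductivity.Theorems.PerturbedFermiCurve
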